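import Summits.ResolutionOfSingularities.ResolutionOfSingularities.Theorems.PurelyInseparableDim4ChartAtlasSNCCriterion
import HarnessLib

/-!
# Purely inseparable four-folds `z^p + F(x₁, …, x₄)`: OFF-centre sheared boundary members are harmless — the positive half of
# the S3-N2 chart criterion with off-`T` shears (critic rider C1, K-A3-26b; cell `res-dim4-pi`, typ-2 g5)

[OURS · counted 0 · about OUR S3 (c) strategy; nothing about resolution of singularities] (D-0157 DOOR 2; DR-157-C; desk
WORD #131 (c); crit-3 g4 K-A3-26b rider C1 «an old member {xᵢ = 0} translated away in chart j but NOT in S′ reads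
(xᵢ + bᵢ x_j)·𝒪 with i ∉ T — an OFF-T SHEARED member; p691155 admits constant translations only»). On the cover chart `x_l` the
shear `xᵢ ↦ xᵢ + bᵢ x_j` (`i ∈ S ∖ {j, l}`) turns EVERY old member `{xᵢ = 0}` with `bᵢ ≠ 0` into `(xᵢ + bᵢ x_j)·𝒪`, whether or
not `i` is a direction of the next centre `T`. PROVED here (no `sorry`, no new axiom), on `𝔸⁵_K` with centre
`𝓘Λ_T = 𝓘(V(z, x_T))`:

* `exists_algEquiv_multishear` — the automorphism `Ψ` with `Ψ x_k = x_k + β_k·x_j` for all `k` (`β_j = 0`);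
* `comap_multishear_𝓘Λ`, `comap_multishear_hyperplane` — `Spec Ψ` fixes `𝓘Λ_T` when `β = 0` on `{z} ∪ T`, and carries
  `(x_k + c)·𝒪` to `(x_k + β_k x_j + c)·𝒪`;
* **`hasSNCWith_offShear_translatedHyperplanes_𝓘Λ`** — NO bad member: for `β, c` vanishing on `{z} ∪ T` (`β_j = 0`) and any list `l`
  of coordinates, `HasSNCWith [(xᵢ + βᵢ x_j + cᵢ)·𝒪 : i ∈ l] 𝓘Λ_T`;
* **`hasSNCWith_shear_offShear_translatedHyperplanes_𝓘Λ`** — ONE bad member: for `m ∈ T`, `j ∉ T`, `b ≠ 0`, `j ∉ l`, same `β, c`: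
  `HasSNCWith ((x_m + b x_j)·𝒪 :: [(xᵢ + βᵢ x_j + cᵢ)·𝒪 : i ∈ l]) 𝓘Λ_T`.

With `…ChartAtlasSNCObstruction` (two bad members ⇒ not snc) this makes the chart-level S3-N2 dichotomy «snc ⇔ |B| ≤ 1» kernel on
BOTH sides for every boundary the walk produces on a cover chart (`E₁ = x_l·𝒪`, kept old members `xᵢ·𝒪`, constant-translated
transversal members, off-`T` sheared members, and the bad set `B`). HONEST SCOPE: chart model; resolution of singularities in
dimension ≥ 4 / characteristic `p` is NOT proved anywhere in this programme. bears_on: LADDER-RESOLUTION:D157-DOOR2 (res-dim4-pi).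
Supports stmt-ResolutionOfSingularities-16155 (helper, S3-N2 positive, off-T shears).
-/

-- every declaration of this summit lives under `Summit.ResolutionOfSingularities.ResolutionOfSingularities`
-- (summit = problem), which the duplicate-namespace linter flags; house convention (cf. the Target file).
set_option linter.dupNamespace false

noncomputable section

open MvPolynomial Finset CategoryTheory AlgebraicGeometry Opposite TopologicalSpace
open AlgebraicGeometry.Scheme.IdealSheafData (ofIdealTop vanishingIdeal)

namespace Summit.ResolutionOfSingularities.ResolutionOfSingularities.Theorems.PIDim4

open Literature.AlgebraicGeometry.Resolution
open Literature.AlgebraicGeometry.Resolution.AffinePointBlowup (P A γ coord Wtop ξ)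

namespace ChartDictionary

variable {K : Type} [Field K] {T : Finset (Fin 4)} {j m : Fin 4} {b : K} {β c : Fin (4 + 1) → K}

/-! ## §1 The multi-shear `Ψ`: `x_k ↦ x_k + β_k·x_j` -/

/-- **The multi-shear automorphism** `Ψ` of `K[z, x]`: `Ψ x_k = x_k + β_k·x_j` for every variable (`β_j = 0`; inverse
`x_k ↦ x_k − β_k x_j`). -/
theorem exists_algEquiv_multishear (β : Fin (4 + 1) → K) (hβj : β j.succ = 0) :
    ∃ Ψ : A 4 K ≃ₐ[K] A 4 K, ∀ k : Fin (4 + 1), Ψ (X k) = X k + C (β k) * X j.succ := by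
  let f : Fin (4 + 1) → A 4 K := fun k => X k + C (β k) * X j.succ
  let g : Fin (4 + 1) → A 4 K := fun k => X k - C (β k) * X j.succ
  have hfj : aeval f (X j.succ : A 4 K) = X j.succ := by
    rw [aeval_X]; change X j.succ + C (β j.succ) * X j.succ = _; rw [hβj, C_0, zero_mul, add_zero]
  have hgj : aeval g (X j.succ : A 4 K) = X j.succ := by
    rw [aeval_X]; change X j.succ - C (β j.succ) * X j.succ = _; rw [hβj, C_0, zero_mul, sub_zero]
  refine ⟨AlgEquiv.ofAlgHom (aeval f) (aeval g) ?_ ?_, fun k => ?_⟩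
  · refine MvPolynomial.algHom_ext fun k => ?_
    rw [AlgHom.comp_apply, AlgHom.id_apply, aeval_X]
    change aeval f (X k - C (β k) * X j.succ) = X k
    rw [map_sub, map_mul, aeval_C, hfj, aeval_X, algebraMap_eq]
    change X k + C (β k) * X j.succ - _ = _
    rw [add_sub_cancel_right]
  · refine MvPolynomial.algHom_ext fun k => ?_
    rw [AlgHom.comp_apply, AlgHom.id_apply, aeval_X]
    change aeval g (X k + C (β k) * X j.succ) = X k
    rw [map_add, map_mul, aeval_C, hgj, aeval_X, algebraMap_eq]
    change X k - C (β k) * X j.succ + _ = _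
    rw [sub_add_cancel]
  · change aeval f (X k) = _
    rw [aeval_X]

/-! ## §2 `Spec Ψ` on the centre and on the hyperplane sheaves -/

/-- `Spec Ψ` fixes `𝓘Λ_Λ` when `β = 0` on `Λ`. -/
theorem comap_multishear_𝓘Λ {Ψ : A 4 K ≃ₐ[K] A 4 K} (hΨ : ∀ k : Fin (4 + 1), Ψ (X k) = X k + C (β k) * X j.succ)
    {Λ : Set (Fin (4 + 1))} (hβ : ∀ k ∈ Λ, β k = 0) :
    (AffineCoordBlowup.𝓘Λ 4 K Λ).comap (Spec.map (CommRingCat.ofHom (Ψ : A 4 K →+* A 4 K))) = AffineCoordBlowup.𝓘Λ 4 K Λ :=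
  comap_unshear_𝓘Λ fun k hk => by rw [hΨ k, hβ k hk, C_0, zero_mul, add_zero]

/-- `Spec Ψ` carries `(x_k + c)·𝒪` to `(x_k + β_k·x_j + c)·𝒪`. -/
theorem comap_multishear_hyperplane {Ψ : A 4 K ≃ₐ[K] A 4 K} (hΨ : ∀ k : Fin (4 + 1), Ψ (X k) = X k + C (β k) * X j.succ)
    (k : Fin (4 + 1)) (c₀ : K) :
    (ofIdealTop (Ideal.span {(γ 4 K).symm (X k + C c₀)})).comap (Spec.map (CommRingCat.ofHom (Ψ : A 4 K →+* A 4 K))) =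
      ofIdealTop (Ideal.span {(γ 4 K).symm (X k + C (β k) * X j.succ + C c₀)}) := by
  have hC : Ψ (C c₀) = C c₀ := Ψ.commutes c₀
  rw [comap_ofIdealTop_span_γ_symm, RingHom.coe_coe, map_add, hΨ k, hC]

/-- `Spec Ψ` fixes the sheared member `(x_m + b·x_j)·𝒪` when `β_m = β_j = 0`. -/
theorem comap_multishear_shear {Ψ : A 4 K ≃ₐ[K] A 4 K} (hΨ : ∀ k : Fin (4 + 1), Ψ (X k) = X k + C (β k) * X j.succ)
    (hβm : β m.succ = 0) (hβj : β j.succ = 0) (b : K) :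
    (ofIdealTop (Ideal.span {(γ 4 K).symm (X m.succ + C b * X j.succ)})).comap
        (Spec.map (CommRingCat.ofHom (Ψ : A 4 K →+* A 4 K))) =
      ofIdealTop (Ideal.span {(γ 4 K).symm (X m.succ + C b * X j.succ)}) := by
  have hC : Ψ (C b) = C b := Ψ.commutes b
  rw [comap_ofIdealTop_span_γ_symm, RingHom.coe_coe, map_add, map_mul, hΨ m.succ, hΨ j.succ, hC, hβm, hβj]
  simp only [C_0, zero_mul, add_zero]

/-! ## §3 No bad member: off-`T` shears and translations -/

/-- **OFF-`T` SHEARED AND TRANSLATED MEMBERS HAVE SNC WITH THE CENTRE.** For `β, c : Fin 5 → K` vanishing on `Λ_T = {z} ∪ T`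
(`β_j = 0`) and any list `l` of coordinates: `HasSNCWith [(xᵢ + βᵢ·x_j + cᵢ)·𝒪 : i ∈ l] 𝓘Λ_T` (typ-2 g2's translated theorem
transported along `Spec Ψ`). -/
theorem hasSNCWith_offShear_translatedHyperplanes_𝓘Λ (hβj : β j.succ = 0)
    (hβT : ∀ i ∈ insert (0 : Fin (4 + 1)) (Fin.succ '' (T : Set (Fin 4))), β i = 0)
    (hcT : ∀ i ∈ insert (0 : Fin (4 + 1)) (Fin.succ '' (T : Set (Fin 4))), c i = 0) (l : List (Fin (4 + 1))) :
    HasSNCWith (l.map fun i => ofIdealTop (Ideal.span {(γ 4 K).symm (X i + C (β i) * X j.succ + C (c i))}))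
      (AffineCoordBlowup.𝓘Λ 4 K (insert 0 (Fin.succ '' (T : Set (Fin 4))))) := by
  obtain ⟨Ψ, hΨ⟩ := exists_algEquiv_multishear (K := K) β hβj
  haveI : IsIso (CommRingCat.ofHom (Ψ : A 4 K →+* A 4 K)) :=
    (inferInstance : IsIso Ψ.toRingEquiv.toCommRingCatIso.hom)
  have h0 := hasSNCWith_translatedHyperplanes_𝓘Λ (K := K) l c (insert 0 (Fin.succ '' (T : Set (Fin 4)))) hcT
  have h1 := h0.comap_of_isOpenImmersion (Spec.map (CommRingCat.ofHom (Ψ : A 4 K →+* A 4 K)))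
  rw [comap_multishear_𝓘Λ hΨ hβT, List.map_map] at h1
  convert h1 using 1
  refine List.map_congr_left fun i _ => ?_
  rw [Function.comp_apply, comap_multishear_hyperplane hΨ]

/-! ## §4 One bad member together with off-`T` shears and translations -/

/-- **ONE BAD MEMBER PLUS OFF-`T` SHEARS: STILL SNC.** For `m ∈ T`, `j ∉ T`, `b ≠ 0`, `β, c` vanishing on `{z} ∪ T` (`β_j = 0`) and
a list `l` of coordinates with `j ∉ l`: `HasSNCWith ((x_m + b·x_j)·𝒪 :: [(xᵢ + βᵢ·x_j + cᵢ)·𝒪 : i ∈ l]) 𝓘Λ_T`. -/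
theorem hasSNCWith_shear_offShear_translatedHyperplanes_𝓘Λ (hmT : m ∈ T) (hjT : j ∉ T) (hb : b ≠ 0) (hβj : β j.succ = 0)
    (hβT : ∀ i ∈ insert (0 : Fin (4 + 1)) (Fin.succ '' (T : Set (Fin 4))), β i = 0)
    (hcT : ∀ i ∈ insert (0 : Fin (4 + 1)) (Fin.succ '' (T : Set (Fin 4))), c i = 0) (l : List (Fin (4 + 1)))
    (hjl : j.succ ∉ l) :
    HasSNCWith (ofIdealTop (Ideal.span {(γ 4 K).symm (X m.succ + C b * X j.succ)}) ::
        l.map fun i => ofIdealTop (Ideal.span {(γ 4 K).symm (X i + C (β i) * X j.succ + C (c i))}))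
      (AffineCoordBlowup.𝓘Λ 4 K (insert 0 (Fin.succ '' (T : Set (Fin 4))))) := by
  obtain ⟨Ψ, hΨ⟩ := exists_algEquiv_multishear (K := K) β hβj
  haveI : IsIso (CommRingCat.ofHom (Ψ : A 4 K →+* A 4 K)) :=
    (inferInstance : IsIso Ψ.toRingEquiv.toCommRingCatIso.hom)
  have hβm : β m.succ = 0 := hβT _ (Set.mem_insert_of_mem _ ⟨m, Finset.mem_coe.mpr hmT, rfl⟩)
  have h0 := hasSNCWith_shear_translatedHyperplanes_𝓘Λ (K := K) hmT hjT hb l hjl c hcT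
  have h1 := h0.comap_of_isOpenImmersion (Spec.map (CommRingCat.ofHom (Ψ : A 4 K →+* A 4 K)))
  rw [comap_multishear_𝓘Λ hΨ hβT] at h1
  simp only [List.map_cons, List.map_map] at h1
  convert h1 using 2
  · rw [comap_multishear_shear hΨ hβm hβj]
  · refine List.map_congr_left fun i _ => ?_
    rw [Function.comp_apply, comap_multishear_hyperplane hΨ]

end ChartDictionary

end Summit.ResolutionOfSingularities.ResolutionOfSingularities.Theorems.PIDim4

end
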